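import Summits.BirchSwinnertonDyer.BirchSwinnertonDyer.Theorems.SignedLowerHalvesSprungLowerHalfAtThreeChromaticReduction
import Literature.NumberTheory.EllipticCurves.FouquetWan2021.KatoMainConjecturePPartOPEN
import Literature.NumberTheory.EllipticCurves.BSDSelmerPConverse
import HarnessLib

/-!
# Route `SignedLowerHalves`, crux `SprungLowerHalfAtThree` (item stmt-BirchSwinnertonDyer-19003): clause (B)
# (`stub_chromaticDivisibility`) on X8 ∩ (Fouquet–Wan locus) ∩ {r_an ≤ 1}, CLOSED MODULO the ONE OPEN binder
# `FouquetWan2021.cor54_pPart_rankZero_OPEN` (cell `bsd-ssimc`, seat `bsd-ssimc-k3-c5` gen 0; a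
# `--supports … --as helper` file, closes nothing)

PARTITION (cell bsd-ssimc): X8 (A8) ∩ FW locus — planner census W-bf-9 (`bsd-ssimc-plan/census/fw_x8.tsv`,
FW-CENSUS.md): 121 of the 217 X8 cells of conductor < 5·10⁵ carry a prime `ℓ ≠ 3` of NON-SPLIT
multiplicative reduction with `3 ∤ ord_ℓ(Δ_min)` (rank 0, surj: 68; rank 1, surj: 53) — types-the-object-of;
closes NONE. THEOREMS ONLY; nothing booked; the binder is an UNREFEREED claim carried by name.

Companion of `SignedLowerHalvesSprungLowerHalfAtThreeChromaticReduction.lean` (p417882: clause (B) of crux 5 is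
Λ-free — at `r_an = 0` it is `MissingLowerBoundAt W 3`, off corank `0` it is vacuous) and of the cell's
Literature binder file `FouquetWan2021/KatoMainConjecturePPartOPEN.lean` (lev g5, p412876), whose OPEN
hypothesis `cor54_pPart_rankZero_OPEN` is typed for ANY odd good supersingular prime — `p = 3`, `a_3 = ±3`
included, as the preprint prints «arbitrary reduction type at `p`» — and whose conditional theorem
`bsdp_of_cor54_OPEN_of_analyticRank_eq_zero` already carries the `p = 3` period fact. Composition: on the
locus, `Sel_{3^∞}(E/ℚ)` infinite ⇒ (B) trivially; finite ⇒ Mordell–Weil rank `0` (corank identity, Greenberg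
LNM 1716 §1) ⇒ `r_an = 0` (GZK, `r_an ≤ 1`) ⇒ `BSD(E,3)` from the binder ⇒ `MissingLowerBoundAt W 3` ⇒ (B)
(`chromaticDatum_of_missingLowerBoundAt`). AUDIT FLAG (honest): the cell's W-lev-9 audit of Fouquet–Wan
(HOME/bsd-ssimc-lev/MEMO-5 + addA–D; REPORT-lev-7 PASS) read the `a_p = 0` case at `p ≥ 5`; at `p = 3` it
records item A-KATO-3 (FW's (TheoKatoIntro) wants `SL₂(ℤ_3)`-image over `ℚ(ζ_{3^∞})`), and the `a_3 = ±3`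
Eisenstein side (FW §7 over Wan arXiv:1607.07729, general non-ordinary `f`) is UNAUDITED by the cell — the
referee decides whether the X8 instance of the binder is «PRE-claimed» or «PRE-unread».

References: [FouquetWan2021] Thm. 5.1 / Cor. 5.4 (p. 53) (PRE); [Sprung2012] Prop. 7.19 (Kato IMC ⇔ ♯/♭ MC);
[Sprung2017] Cor. 4.11; [GreenbergLNM1716] §1; [GreenbergVatsal2000] Rem. 3.4; [Miller2011LMS] Def. 1.1.
-/

set_option autoImplicit false
set_option linter.dupNamespace false

noncomputable section

open scoped Classical MatrixGroups ModularForm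

open CongruenceSubgroup WeierstrassCurve Literature.NumberTheory.EllipticCurves
  Literature.NumberTheory.EllipticCurves.ModularForms
  Literature.NumberTheory.EllipticCurves.Rank1Residual
  Literature.NumberTheory.EllipticCurves.Rank1Residual.Typed
  Literature.NumberTheory.EllipticCurves.Sprung2017
  Summit.BirchSwinnertonDyer.Rank1Residual.Supersingular

namespace Summit.BirchSwinnertonDyer.BirchSwinnertonDyer.Theorems

/-- **At corank zero the Mordell–Weil rank is zero** (`corank Sel_{p^∞} = rank + corank Ш[p^∞]`,
Greenberg LNM 1716 §1, tree theorem `selmerCorank_eq_mordellWeilRank_add_holds`). [cite: GreenbergLNM1716, §1 p. 54] -/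
theorem mordellWeilRank_eq_zero_of_finite_selmerGroupPInfty (W : WeierstrassCurve ℚ) [W.IsElliptic]
    (p : ℕ) [Fact p.Prime] (hfin : Finite (W.selmerGroupPInfty p)) : W.mordellWeilRank = 0 := by
  haveI := hfin
  have h0 : W.selmerCorank p = 0 := W.selmerCorank_eq_zero_of_finite p
  have h := W.selmerCorank_eq_mordellWeilRank_add_holds p
  omega

/-- **X8 ∩ (Fouquet–Wan locus), analytic rank ≤ 1: `stub_chromaticDivisibility` MODULO the ONE OPEN binder
`FouquetWan2021.cor54_pPart_rankZero_OPEN`.** For a globally minimal `W` on class X8 (`p = 3`, good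
supersingular, `a_3 = ±3`) with a prime `ℓ ≠ 3` of NON-SPLIT multiplicative reduction and `3 ∤ ord_ℓ(Δ_min)`
(FW Thm. 5.1's ramified-Steinberg hypothesis at `k = 2`; `E[3]` irreducible and `ρ̄|G_{ℚ_3}` irreducible are
automatic at a supersingular `3`) and `ord_{s=1} L(E,s) ≤ 1`: IF the claimed FW Cor. 5.4 holds (`hFW_OPEN`,
UNREFEREED — typed by the cell for ANY odd good supersingular prime, `a_p ≠ 0` included, exactly as printed
«arbitrary reduction type at p»), then for the newform `f` of `W`, its period ratio `ϖ` and ANY Sprung pair,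
clause (B) of crux 5 holds (colour `♭`). Cases: `Sel_{3^∞}(E/ℚ)` infinite ⇒ trivial witness; finite ⇒
rank `0` (corank identity) ⇒ `r_an = 0` (GZK, `r_an ≤ 1`) ⇒ `BSD(E,3)` from the binder
(`FouquetWan2021.bsdp_of_cor54_OPEN_of_analyticRank_eq_zero`: modularity `hnf`, GZK, period facts `h5`/`h3`)
⇒ `MissingLowerBoundAt W 3` ⇒ (B) by `chromaticDatum_of_missingLowerBoundAt`. AUDIT FLAG (honest): the
cell's W-lev-9 audit of FW (HOME/bsd-ssimc-lev/MEMO-5 + addA–D, REPORT-lev-7 PASS) read the `a_p = 0` case at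
`p ≥ 5`; at `p = 3` it records A-KATO-3 (FW's (TheoKatoIntro) wants `SL₂(ℤ_3)`-image over `ℚ(ζ_{3^∞})`), and
the `a_3 = ±3` Eisenstein side (Wan arXiv:1607.07729 for general non-ordinary `f`) is UNAUDITED by the cell.
CONDITIONAL; closes nothing; nothing booked. [claim: FouquetWan2021, status: under-review]
[cite: Sprung2017, Cor. 4.11 (table of special values)] [cite: GreenbergVatsal2000, §3 Remark 3.4]
[cite: GreenbergLNM1716, §1 p. 54] [cite: Miller2011LMS, Def. 1.1] -/
theorem X8_chromaticDivisibility_fwLocus_of_cor54_OPEN_of_analyticRank_le_one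
    (hFW_OPEN : FouquetWan2021.cor54_pPart_rankZero_OPEN)
    (hnf : exists_isNewformOf) (hGZK : rank_eq_analyticRank_of_analyticRank_le_one)
    (hmod : hasEntireLFunction_rat)
    (h5 : realPeriodRat_eq_unit_mul_plusPeriod) (h3 : realPeriodRat_eq_unit_mul_plusPeriod_three)
    (W : WeierstrassCurve ℚ) [W.IsElliptic] [W.IsGloballyMinimal] (p : ℕ) [Fact p.Prime]
    (hX : ClassX8 W p)
    (hFW : ∃ (ℓ : ℕ) (_ : Fact ℓ.Prime), ℓ ≠ p ∧ W.HasMultiplicativeReductionAtPrime ℓ ∧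
        ¬ W.HasSplitMultiplicativeReductionAtPrime ℓ ∧ ¬ p ∣ padicValInt ℓ W.minimalDiscriminantInt)
    (hr : W.analyticRank ≤ 1)
    {N : ℕ} [NeZero N] {f : CuspForm (Gamma0 N) 2} (hf : IsNewformOf W f)
    {ϖ : ℚ} (hϖ : (ϖ : ℝ) * W.realPeriodRat = plusPeriod f)
    {Lsharp Lflat : IwasawaAlgebra p} (hSP : IsSprungPair f p (W.frobeniusTrace p) Lsharp Lflat) :
    ∃ (c : Chroma) (ξ : IwasawaAlgebra p), (⟨ξ, 0, 0⟩ : SignedDatum W p).EulerCharacteristic ∧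
      ∃ h : IwasawaAlgebra p, iwasawaToPowerSeries p ξ =
        PowerSeries.C (ϖ : ℚ_[p]) * iwasawaToPowerSeries p (chromaticL c Lsharp Lflat * h) := by
  have hp3 : p = 3 := hX.1
  subst hp3
  by_cases hfin : Finite (W.selmerGroupPInfty 3)
  · have hrk : W.mordellWeilRank = 0 := mordellWeilRank_eq_zero_of_finite_selmerGroupPInfty W 3 hfin
    have hr0 : W.analyticRank = 0 := by
      have h := (hGZK W hr).1
      omega
    haveI : Finite W.sha := (hGZK W hr).2
    have hBSD : BSDp W 3 := FouquetWan2021.bsdp_of_cor54_OPEN_of_analyticRank_eq_zero hFW_OPEN hnf hGZK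
      h5 h3 W 3 (by decide) hX.2.1.1 hX.2.1.2 hFW hr0
    have hlow : MissingLowerBoundAt W 3 :=
      (lower_and_upper_of_missingPPartAt W 3 (missingPPartAt_of_bsdp W 3 hBSD)).1
    have hL : W.entireLFunction 1 ≠ 0 := (W.analyticRank_eq_zero_iff_holds (hmod W)).1 hr0
    have hϖ1 : ‖(ϖ : ℚ_[3])‖ ≤ 1 := (X8_norm_periodRatio_eq_one h3 W 3 hX hf hϖ).le
    obtain ⟨ξ, hK, hdiv⟩ := chromaticDatum_of_missingLowerBoundAt W 3 hGZK (by decide) hX.2.1.1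
      (ClassX8.irr W 3 hX) hL hf hϖ hϖ1 hSP .flat (ClassX8.not_dvd_chromaticConst' W 3 hX .flat) hlow
    exact ⟨.flat, ξ, hK, hdiv⟩
  · obtain ⟨ξ, hK, hdiv⟩ := chromaticDatum_of_not_finite_selmer W 3 hfin ϖ (chromaticL .flat Lsharp Lflat)
    exact ⟨.flat, ξ, hK, hdiv⟩

/-- **The same in the registered stub's binder order** (`stub_chromaticDivisibility` restricted to the
Fouquet–Wan locus and analytic rank ≤ 1, the leaf's regime), MODULO the one OPEN binder and the published
facts. What it buys on X8: the rank-0 large-image cells of board A8 that carry a non-split multiplicative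
prime `ℓ` with `3 ∤ ord_ℓ(Δ)` would read «PRE-claimed (FW Cor. 5.4 at `p = 3`, `a_3 = ±3`)» for crux 5's
clause (B) — subject to the audit flag above; rank-1 cells are trivial for (B) as typed. CONDITIONAL;
closes nothing. [claim: FouquetWan2021, status: under-review] [cite: Miller2011LMS, Def. 1.1] -/
theorem stub_chromaticDivisibility_fwLocus_of_cor54_OPEN
    (hFW_OPEN : FouquetWan2021.cor54_pPart_rankZero_OPEN)
    (hnf : exists_isNewformOf) (hGZK : rank_eq_analyticRank_of_analyticRank_le_one)
    (hmod : hasEntireLFunction_rat)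
    (h5 : realPeriodRat_eq_unit_mul_plusPeriod) (h3 : realPeriodRat_eq_unit_mul_plusPeriod_three) :
    ∀ (W : WeierstrassCurve ℚ) [W.IsElliptic] [W.IsGloballyMinimal] (p : ℕ) [Fact p.Prime],
      Literature.NumberTheory.EllipticCurves.Rank1Residual.ClassX8 W p →
      (∃ (ℓ : ℕ) (_ : Fact ℓ.Prime), ℓ ≠ p ∧ W.HasMultiplicativeReductionAtPrime ℓ ∧
        ¬ W.HasSplitMultiplicativeReductionAtPrime ℓ ∧ ¬ p ∣ padicValInt ℓ W.minimalDiscriminantInt) →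
      W.analyticRank ≤ 1 →
      ∀ (N : ℕ) (_ : NeZero N) (f : CuspForm (CongruenceSubgroup.Gamma0 N) 2) (ϖ : ℚ)
        (Lsharp Lflat : Literature.NumberTheory.EllipticCurves.IwasawaAlgebra p),
        Literature.NumberTheory.EllipticCurves.ModularForms.IsNewformOf W f →
        (ϖ : ℝ) * W.realPeriodRat = Literature.NumberTheory.EllipticCurves.ModularForms.plusPeriod f →
        Literature.NumberTheory.EllipticCurves.Sprung2017.IsSprungPair f p (W.frobeniusTrace p)
          Lsharp Lflat →
        ∃ (c : Literature.NumberTheory.EllipticCurves.Sprung2017.Chroma)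
          (ξ : Literature.NumberTheory.EllipticCurves.IwasawaAlgebra p),
          (⟨ξ, 0, 0⟩ : Summit.BirchSwinnertonDyer.Rank1Residual.Supersingular.SignedDatum W p).EulerCharacteristic ∧
          ∃ h : Literature.NumberTheory.EllipticCurves.IwasawaAlgebra p,
            Literature.NumberTheory.EllipticCurves.iwasawaToPowerSeries p ξ =
              PowerSeries.C (ϖ : ℚ_[p]) *
                Literature.NumberTheory.EllipticCurves.iwasawaToPowerSeries p
                  (Literature.NumberTheory.EllipticCurves.Sprung2017.chromaticL c Lsharp Lflat * h) := by
  intro W _ _ p _ hX hFW hr N hN f ϖ Lsharp Lflat hf hϖ hSP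
  exact X8_chromaticDivisibility_fwLocus_of_cor54_OPEN_of_analyticRank_le_one hFW_OPEN hnf hGZK hmod h5 h3
    W p hX hFW hr hf hϖ hSP

end Summit.BirchSwinnertonDyer.BirchSwinnertonDyer.Theorems

end
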